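import Mathlib
import HarnessLib
import Summits.HubbardSuperconductivity.HubbardSuperconductivity.Theorems.KLProgrammeC4aPartnerBandTangencyDefectSharp
import Summits.HubbardSuperconductivity.HubbardSuperconductivity.Theorems.KLProgrammeC4aRadialRowsTwoThree
import Summits.HubbardSuperconductivity.HubbardSuperconductivity.Theorems.KLProgrammeC4aRadialRowOne
import Summits.HubbardSuperconductivity.HubbardSuperconductivity.Theorems.KLProgrammeC4aLevelDensityRadialVertex

/-!
# Route `KLProgramme` — crux C4a, S3 brick (B2, TANGENCY, ORDERS ≤ 3 UNCONDITIONAL): the co-moving jets of the pp / ph partner band near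
# tangency at every order `k ≤ 3`, with the radial rows DISCHARGED from the tree

Cell `gate-hubbard-kl`, seat hubbard-kl-k3c3-p3 (g23; row «implicit-function / monotonicity route»).  Located brick «(B2)-TAN-ALL», closing file for
order `3` of C4A-PLAN §24.8/§24.9 («orders 3–4 at (T)»), for the (C)-closer lane hubbard-kl-c4a-1 (stub (C) `stub_twoLeg_curvature` of
`KLRegimeEngineV17F2`, stmt-HubbardSuperconductivity-20437).  The sharp reductions `…C4aPartnerBandTangencyDefectSharp` need the radial rows
`‖Φ_x⁽ⁱ⁾ − Φ_0⁽ⁱ⁾‖ ≤ RRᵢ·|x|` for `i ≤ k` only; for `i ≤ 3` these are LANDED (`norm_levelPoint_sub_levelPoint_le` (`1/d`),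
`norm_iteratedDeriv_one_levelPoint_sub_le` (`radialRowOneConst A d`), `norm_iteratedDeriv_two_levelPoint_sub_le`
(`uRowTwoConst A A₃ d + 1/d + 2(radialRowOneConst A d − 1/d)`), `norm_iteratedDeriv_three_levelPoint_sub_le`
(`uRowThreeConst A A₃ A₄ d + 3(radialRowOneConst A d − 1/d) + 3·uRowTwoConst A A₃ d + 1/d`), `d = Dt_min − 2A`):

* `radialRows_le_three` — any `RR : ℕ → ℝ` dominating these four closed-form constants is a row majorant for `i ≤ 3` (and is nonnegative there,
  `radialRows_nonneg_of_le_three`);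
* **`abs_iteratedDeriv_partnerBand_pp_tangency_le_of_le_three`** / **`_ph_`** — for EVERY `k ≤ 3`, all `|ρ|, |e| < r`, `ϑ, θ, φ`:
  `|∂ᵏ_t|₀ e_K(S_{ρϑθ}(t) − Φ(e,φ+θ+t))| ≤ (k+2)!·𝒦·(3𝒟)^{k+2}·φ² + |e|·(k+1)!·𝒦·R₁·D₁ᵏ + (|ρ|+|ϑ|)·(k+1)!·𝒦·R₂·D₂ᵏ` (ph with `|ϑ − π|`),
  the constants being ANY majorants of closed-form expressions in `A, A₃, A₄, A₅, A₆, Dt_min − 2A` (the hypotheses `hK hD h0 h1 h2 h3 hD₁ hR₁ hD₂ hR₂`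
  are inequalities between such expressions only) — UNCONDITIONAL, uniform in the frame `K` given its sizes, `n`-free.

Order `4` is `…Sharp` with the single extra input `RR₄`.  Proved bookkeeping on landed objects; nothing about the Hubbard model's sizes; nothing
asserts superconductivity.  References: FST II CPAM 51 (1998) §3; BGM 2006 §2.4 Lemma 2.1 (2.40)–(2.41) [cite: BenfattoGiulianiMastropietro2006].
-/

noncomputable section

namespace Summit.HubbardSuperconductivity.HubbardSuperconductivity.Theorems.C4a

set_option linter.dupNamespace false -- summit = problem name (single-conjunct summit), D-0017

open Real Set Filter
open scoped Topology
open Literature.MathematicalPhysics.QuantumLattice Literature.MathematicalPhysics.QuantumLattice.BandSectorCounting Literature.Probability.LatticeModels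
open Summit.HubbardSuperconductivity.HubbardSuperconductivity.Theorems.KLRegimeSplit
open Summit.HubbardSuperconductivity.HubbardSuperconductivity.Theorems.DispersionFlow
open Summit.HubbardSuperconductivity.HubbardSuperconductivity.Theorems.PerturbedFermiCurve

section Sizes

variable {K : TrigPolyC4v} {A : ℝ} (hA : ∀ p : Momentum, ∀ j ≤ 2, ‖iteratedFDeriv ℝ j (frameShift K) p‖ ≤ A) (hA20 : A ≤ 1 / 20)
  (hd : klCurveD ≤ (bandBounds (show (-4 : ℝ) < -1.1 by norm_num) (show (-1.1 : ℝ) ≤ -0.1 by norm_num)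
    (show (-0.1 : ℝ) < 0 by norm_num)).Dtmin - 2 * A)
  {μ r : ℝ} (hr : 0 < r) (hlo : (-1.1 : ℝ) < μ - r - A) (hhi : μ + r + A < -0.1)
  {A₃ A₄ A₅ A₆ : ℝ} (hA₃ : ∀ p : Momentum, ‖iteratedFDeriv ℝ 3 (frameShift K) p‖ ≤ A₃)
  (hA₄ : ∀ p : Momentum, ‖iteratedFDeriv ℝ 4 (frameShift K) p‖ ≤ A₄)
  (hA₅ : ∀ p : Momentum, ‖iteratedFDeriv ℝ 5 (frameShift K) p‖ ≤ A₅)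
  (hA₆ : ∀ p : Momentum, ‖iteratedFDeriv ℝ 6 (frameShift K) p‖ ≤ A₆)
include hA hA20 hd hr hlo hhi hA₃ hA₄ hA₅ hA₆

/-! ## §1 The radial rows to order three are in the tree -/

omit hA₅ hA₆ in
/-- **Radial rows to order three from the tree**: if `RR 0 ≥ 1/d`, `RR 1 ≥ radialRowOneConst A d`, `RR 2 ≥ uRowTwoConst A A₃ d + 1/d + 2(radialRowOneConst A d − 1/d)`,
`RR 3 ≥ uRowThreeConst A A₃ A₄ d + 3(radialRowOneConst A d − 1/d) + 3·uRowTwoConst A A₃ d + 1/d` (`d = Dt_min − 2A`), then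
`‖Φ_x⁽ⁱ⁾(s) − Φ_0⁽ⁱ⁾(s)‖ ≤ RR i·|x|` for `i ≤ 3`, `|x| < r`. [cite: BenfattoGiulianiMastropietro2006, §2.4 Lemma 2.1 (2.40)–(2.41)] -/
theorem radialRows_le_three {RR : ℕ → ℝ}
    (h0 : 1 / ((bandBounds (show (-4 : ℝ) < -1.1 by norm_num) (show (-1.1 : ℝ) ≤ -0.1 by norm_num) (show (-0.1 : ℝ) < 0 by norm_num)).Dtmin - 2 * A) ≤ RR 0)
    (h1 : radialRowOneConst A ((bandBounds (show (-4 : ℝ) < -1.1 by norm_num) (show (-1.1 : ℝ) ≤ -0.1 by norm_num) (show (-0.1 : ℝ) < 0 by norm_num)).Dtmin -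
      2 * A) ≤ RR 1)
    (h2 : uRowTwoConst A A₃ ((bandBounds (show (-4 : ℝ) < -1.1 by norm_num) (show (-1.1 : ℝ) ≤ -0.1 by norm_num) (show (-0.1 : ℝ) < 0 by norm_num)).Dtmin -
          2 * A) +
        1 / ((bandBounds (show (-4 : ℝ) < -1.1 by norm_num) (show (-1.1 : ℝ) ≤ -0.1 by norm_num) (show (-0.1 : ℝ) < 0 by norm_num)).Dtmin - 2 * A) +
        2 * (radialRowOneConst A ((bandBounds (show (-4 : ℝ) < -1.1 by norm_num) (show (-1.1 : ℝ) ≤ -0.1 by norm_num)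
          (show (-0.1 : ℝ) < 0 by norm_num)).Dtmin - 2 * A) -
          1 / ((bandBounds (show (-4 : ℝ) < -1.1 by norm_num) (show (-1.1 : ℝ) ≤ -0.1 by norm_num) (show (-0.1 : ℝ) < 0 by norm_num)).Dtmin -
            2 * A)) ≤ RR 2)
    (h3 : uRowThreeConst A A₃ A₄ ((bandBounds (show (-4 : ℝ) < -1.1 by norm_num) (show (-1.1 : ℝ) ≤ -0.1 by norm_num)
          (show (-0.1 : ℝ) < 0 by norm_num)).Dtmin - 2 * A) +
        3 * (radialRowOneConst A ((bandBounds (show (-4 : ℝ) < -1.1 by norm_num) (show (-1.1 : ℝ) ≤ -0.1 by norm_num)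
          (show (-0.1 : ℝ) < 0 by norm_num)).Dtmin - 2 * A) -
          1 / ((bandBounds (show (-4 : ℝ) < -1.1 by norm_num) (show (-1.1 : ℝ) ≤ -0.1 by norm_num) (show (-0.1 : ℝ) < 0 by norm_num)).Dtmin -
            2 * A)) +
        3 * uRowTwoConst A A₃ ((bandBounds (show (-4 : ℝ) < -1.1 by norm_num) (show (-1.1 : ℝ) ≤ -0.1 by norm_num)
          (show (-0.1 : ℝ) < 0 by norm_num)).Dtmin - 2 * A) +
        1 / ((bandBounds (show (-4 : ℝ) < -1.1 by norm_num) (show (-1.1 : ℝ) ≤ -0.1 by norm_num) (show (-0.1 : ℝ) < 0 by norm_num)).Dtmin -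
          2 * A) ≤ RR 3)
    {x : ℝ} (hx : |x| < r) : ∀ i, i ≤ 3 → ∀ s, ‖iteratedDeriv i (levelPoint μ K x) s - iteratedDeriv i (levelPoint μ K 0) s‖ ≤ RR i * |x| := by
  set B₀ := bandBounds (show (-4 : ℝ) < -1.1 by norm_num) (show (-1.1 : ℝ) ≤ -0.1 by norm_num) (show (-0.1 : ℝ) < 0 by norm_num) with hB₀
  have hADt : 2 * A < B₀.Dtmin := by have := klCurveD_pos; linarith
  intro i hi s
  have hxabs : 0 ≤ |x| := abs_nonneg x
  interval_cases i
  · rw [iteratedDeriv_zero]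
    have h := norm_levelPoint_sub_levelPoint_le B₀ hA hADt hlo hhi (ρ := x) (ρ' := 0) ⟨(abs_lt.1 hx).1, (abs_lt.1 hx).2⟩ ⟨by linarith, hr⟩ s
    rw [sub_zero, div_eq_mul_one_div, mul_comm] at h
    exact h.trans (mul_le_mul_of_nonneg_right h0 hxabs)
  · exact (norm_iteratedDeriv_one_levelPoint_sub_le hA hd hr hlo hhi hx s).trans (mul_le_mul_of_nonneg_right h1 hxabs)
  · exact (norm_iteratedDeriv_two_levelPoint_sub_le hA hA20 hd hr hlo hhi hA₃ hA₄ hx s).trans (mul_le_mul_of_nonneg_right h2 hxabs)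
  · exact (norm_iteratedDeriv_three_levelPoint_sub_le hA hA20 hd hr hlo hhi hA₃ hA₄ hx s).trans (mul_le_mul_of_nonneg_right h3 hxabs)

omit hA hA20 hd hlo hhi hA₃ hA₄ hA₅ hA₆ in
/-- Such a row majorant is nonnegative at `i ≤ 3` (read the row at the level `r/2`). -/
theorem radialRows_nonneg_of_le_three {RR : ℕ → ℝ}
    (hrows : ∀ {x : ℝ}, |x| < r → ∀ i, i ≤ 3 → ∀ s, ‖iteratedDeriv i (levelPoint μ K x) s - iteratedDeriv i (levelPoint μ K 0) s‖ ≤ RR i * |x|) :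
    ∀ i, i ≤ 3 → 0 ≤ RR i := by
  intro i hi
  have hx : |r / 2| < r := by rw [abs_of_pos (by positivity)]; linarith
  have h := (norm_nonneg _).trans (hrows hx i hi 0)
  have hpos : 0 < |r / 2| := by rw [abs_of_pos (by positivity)]; positivity
  nlinarith

/-! ## §2 Orders `k ≤ 3`, unconditional -/

/-- **THE `k`-TH CO-MOVING JET OF THE pp PARTNER BAND NEAR TANGENCY, `k ≤ 3`, UNCONDITIONAL**: for any row majorant `RR` of the four landed
closed-form rows (`h0…h3`), any band/curve majorants `𝒦, 𝒟` and bases `D₁, R₁, D₂, R₂` as in `…Sharp`: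
`|∂ᵏ_t|₀ e_K(S_{ρϑθ}(t) − Φ(e,φ+θ+t))| ≤ (k+2)!·𝒦·(3𝒟)^{k+2}·φ² + |e|·(k+1)!·𝒦·R₁·D₁ᵏ + (|ρ|+|ϑ|)·(k+1)!·𝒦·R₂·D₂ᵏ`. -/
theorem abs_iteratedDeriv_partnerBand_pp_tangency_le_of_le_three {k : ℕ} (hk : k ≤ 3) {𝒦 𝒟 : ℝ}
    (hK : ∀ i, 1 ≤ i → i ≤ k + 2 → ∀ p : Momentum, ‖iteratedFDeriv ℝ i (frameLevel μ K) p‖ ≤ 𝒦)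
    (hD : ∀ i, 1 ≤ i → i ≤ k + 2 → msD6 A₃ A₄ A₅ A₆ i ≤ 𝒟 ^ i) {RR : ℕ → ℝ}
    (h0 : 1 / ((bandBounds (show (-4 : ℝ) < -1.1 by norm_num) (show (-1.1 : ℝ) ≤ -0.1 by norm_num) (show (-0.1 : ℝ) < 0 by norm_num)).Dtmin - 2 * A) ≤ RR 0)
    (h1 : radialRowOneConst A ((bandBounds (show (-4 : ℝ) < -1.1 by norm_num) (show (-1.1 : ℝ) ≤ -0.1 by norm_num) (show (-0.1 : ℝ) < 0 by norm_num)).Dtmin -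
      2 * A) ≤ RR 1)
    (h2 : uRowTwoConst A A₃ ((bandBounds (show (-4 : ℝ) < -1.1 by norm_num) (show (-1.1 : ℝ) ≤ -0.1 by norm_num) (show (-0.1 : ℝ) < 0 by norm_num)).Dtmin -
          2 * A) +
        1 / ((bandBounds (show (-4 : ℝ) < -1.1 by norm_num) (show (-1.1 : ℝ) ≤ -0.1 by norm_num) (show (-0.1 : ℝ) < 0 by norm_num)).Dtmin - 2 * A) +
        2 * (radialRowOneConst A ((bandBounds (show (-4 : ℝ) < -1.1 by norm_num) (show (-1.1 : ℝ) ≤ -0.1 by norm_num)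
          (show (-0.1 : ℝ) < 0 by norm_num)).Dtmin - 2 * A) -
          1 / ((bandBounds (show (-4 : ℝ) < -1.1 by norm_num) (show (-1.1 : ℝ) ≤ -0.1 by norm_num) (show (-0.1 : ℝ) < 0 by norm_num)).Dtmin -
            2 * A)) ≤ RR 2)
    (h3 : uRowThreeConst A A₃ A₄ ((bandBounds (show (-4 : ℝ) < -1.1 by norm_num) (show (-1.1 : ℝ) ≤ -0.1 by norm_num)
          (show (-0.1 : ℝ) < 0 by norm_num)).Dtmin - 2 * A) +
        3 * (radialRowOneConst A ((bandBounds (show (-4 : ℝ) < -1.1 by norm_num) (show (-1.1 : ℝ) ≤ -0.1 by norm_num)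
          (show (-0.1 : ℝ) < 0 by norm_num)).Dtmin - 2 * A) -
          1 / ((bandBounds (show (-4 : ℝ) < -1.1 by norm_num) (show (-1.1 : ℝ) ≤ -0.1 by norm_num) (show (-0.1 : ℝ) < 0 by norm_num)).Dtmin -
            2 * A)) +
        3 * uRowTwoConst A A₃ ((bandBounds (show (-4 : ℝ) < -1.1 by norm_num) (show (-1.1 : ℝ) ≤ -0.1 by norm_num)
          (show (-0.1 : ℝ) < 0 by norm_num)).Dtmin - 2 * A) +
        1 / ((bandBounds (show (-4 : ℝ) < -1.1 by norm_num) (show (-1.1 : ℝ) ≤ -0.1 by norm_num) (show (-0.1 : ℝ) < 0 by norm_num)).Dtmin -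
          2 * A) ≤ RR 3)
    {ρ : ℝ} (hρ : |ρ| < r) {e : ℝ} (he : |e| < r) (ϑ : ℝ) {D₁ R₁ D₂ R₂ : ℝ} (hD₁0 : 0 ≤ D₁) (hR₁0 : 0 ≤ R₁) (hD₂0 : 0 ≤ D₂) (hR₂0 : 0 ≤ R₂)
    (hD₁ : ∀ j, 1 ≤ j → j ≤ k → 3 * msD6 A₃ A₄ A₅ A₆ j + |e| * RR j ≤ D₁ ^ j) (hR₁ : ∀ j, j ≤ k → RR j ≤ R₁ * D₁ ^ j)
    (hD₂ : ∀ j, 1 ≤ j → j ≤ k → 3 * msD6 A₃ A₄ A₅ A₆ j + (|ρ| + |ϑ|) * (RR j + msD6 A₃ A₄ A₅ A₆ (j + 1)) ≤ D₂ ^ j)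
    (hR₂ : ∀ j, j ≤ k → RR j + msD6 A₃ A₄ A₅ A₆ (j + 1) ≤ R₂ * D₂ ^ j) (θ φ : ℝ) :
    |iteratedDeriv k (fun t : ℝ => frameLevel μ K (pairSumPath μ K ρ ϑ θ t - levelPoint μ K e (φ + θ + t))) 0| ≤
      (k + 2).factorial * 𝒦 * (3 * 𝒟) ^ (k + 2) * φ ^ 2 + |e| * ((k + 1).factorial * 𝒦 * R₁ * D₁ ^ k) +
        (|ρ| + |ϑ|) * ((k + 1).factorial * 𝒦 * R₂ * D₂ ^ k) := by
  have hrows : ∀ {x : ℝ}, |x| < r → ∀ i, i ≤ 3 → ∀ s, ‖iteratedDeriv i (levelPoint μ K x) s - iteratedDeriv i (levelPoint μ K 0) s‖ ≤ RR i * |x| :=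
    fun hx => radialRows_le_three hA hA20 hd hr hlo hhi hA₃ hA₄ h0 h1 h2 h3 hx
  have hRR0 : ∀ i, i ≤ k → 0 ≤ RR i := fun i hi => radialRows_nonneg_of_le_three hr hrows i (hi.trans hk)
  exact abs_iteratedDeriv_partnerBand_pp_tangency_le_sharp hA hA20 hd hr hlo hhi hA₃ hA₄ hA₅ hA₆ (hk.trans (by norm_num)) hK hD hρ he hRR0
    (fun i hi s => hrows he i (hi.trans hk) s) (fun i hi s => hrows hρ i (hi.trans hk) s) ϑ hD₁0 hR₁0 hD₂0 hR₂0 hD₁ hR₁ hD₂ hR₂ θ φ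

/-- **THE `k`-TH CO-MOVING JET OF THE ph PARTNER BAND NEAR `2k_F`, `k ≤ 3`, UNCONDITIONAL** (same constants, `|ϑ − π|`). -/
theorem abs_iteratedDeriv_partnerBand_ph_tangency_le_of_le_three {k : ℕ} (hk : k ≤ 3) {𝒦 𝒟 : ℝ}
    (hK : ∀ i, 1 ≤ i → i ≤ k + 2 → ∀ p : Momentum, ‖iteratedFDeriv ℝ i (frameLevel μ K) p‖ ≤ 𝒦)
    (hD : ∀ i, 1 ≤ i → i ≤ k + 2 → msD6 A₃ A₄ A₅ A₆ i ≤ 𝒟 ^ i) {RR : ℕ → ℝ}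
    (h0 : 1 / ((bandBounds (show (-4 : ℝ) < -1.1 by norm_num) (show (-1.1 : ℝ) ≤ -0.1 by norm_num) (show (-0.1 : ℝ) < 0 by norm_num)).Dtmin - 2 * A) ≤ RR 0)
    (h1 : radialRowOneConst A ((bandBounds (show (-4 : ℝ) < -1.1 by norm_num) (show (-1.1 : ℝ) ≤ -0.1 by norm_num) (show (-0.1 : ℝ) < 0 by norm_num)).Dtmin -
      2 * A) ≤ RR 1)
    (h2 : uRowTwoConst A A₃ ((bandBounds (show (-4 : ℝ) < -1.1 by norm_num) (show (-1.1 : ℝ) ≤ -0.1 by norm_num) (show (-0.1 : ℝ) < 0 by norm_num)).Dtmin -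
          2 * A) +
        1 / ((bandBounds (show (-4 : ℝ) < -1.1 by norm_num) (show (-1.1 : ℝ) ≤ -0.1 by norm_num) (show (-0.1 : ℝ) < 0 by norm_num)).Dtmin - 2 * A) +
        2 * (radialRowOneConst A ((bandBounds (show (-4 : ℝ) < -1.1 by norm_num) (show (-1.1 : ℝ) ≤ -0.1 by norm_num)
          (show (-0.1 : ℝ) < 0 by norm_num)).Dtmin - 2 * A) -
          1 / ((bandBounds (show (-4 : ℝ) < -1.1 by norm_num) (show (-1.1 : ℝ) ≤ -0.1 by norm_num) (show (-0.1 : ℝ) < 0 by norm_num)).Dtmin -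
            2 * A)) ≤ RR 2)
    (h3 : uRowThreeConst A A₃ A₄ ((bandBounds (show (-4 : ℝ) < -1.1 by norm_num) (show (-1.1 : ℝ) ≤ -0.1 by norm_num)
          (show (-0.1 : ℝ) < 0 by norm_num)).Dtmin - 2 * A) +
        3 * (radialRowOneConst A ((bandBounds (show (-4 : ℝ) < -1.1 by norm_num) (show (-1.1 : ℝ) ≤ -0.1 by norm_num)
          (show (-0.1 : ℝ) < 0 by norm_num)).Dtmin - 2 * A) -
          1 / ((bandBounds (show (-4 : ℝ) < -1.1 by norm_num) (show (-1.1 : ℝ) ≤ -0.1 by norm_num) (show (-0.1 : ℝ) < 0 by norm_num)).Dtmin -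
            2 * A)) +
        3 * uRowTwoConst A A₃ ((bandBounds (show (-4 : ℝ) < -1.1 by norm_num) (show (-1.1 : ℝ) ≤ -0.1 by norm_num)
          (show (-0.1 : ℝ) < 0 by norm_num)).Dtmin - 2 * A) +
        1 / ((bandBounds (show (-4 : ℝ) < -1.1 by norm_num) (show (-1.1 : ℝ) ≤ -0.1 by norm_num) (show (-0.1 : ℝ) < 0 by norm_num)).Dtmin -
          2 * A) ≤ RR 3)
    {ρ : ℝ} (hρ : |ρ| < r) {e : ℝ} (he : |e| < r) (ϑ : ℝ) {D₁ R₁ D₂ R₂ : ℝ} (hD₁0 : 0 ≤ D₁) (hR₁0 : 0 ≤ R₁) (hD₂0 : 0 ≤ D₂) (hR₂0 : 0 ≤ R₂)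
    (hD₁ : ∀ j, 1 ≤ j → j ≤ k → 3 * msD6 A₃ A₄ A₅ A₆ j + |e| * RR j ≤ D₁ ^ j) (hR₁ : ∀ j, j ≤ k → RR j ≤ R₁ * D₁ ^ j)
    (hD₂ : ∀ j, 1 ≤ j → j ≤ k → 3 * msD6 A₃ A₄ A₅ A₆ j + (|ρ| + |ϑ - π|) * (RR j + msD6 A₃ A₄ A₅ A₆ (j + 1)) ≤ D₂ ^ j)
    (hR₂ : ∀ j, j ≤ k → RR j + msD6 A₃ A₄ A₅ A₆ (j + 1) ≤ R₂ * D₂ ^ j) (θ φ : ℝ) :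
    |iteratedDeriv k (fun t : ℝ => frameLevel μ K (levelPoint μ K e (φ + θ + t) - pairDiffPath μ K ρ ϑ θ t)) 0| ≤
      (k + 2).factorial * 𝒦 * (3 * 𝒟) ^ (k + 2) * φ ^ 2 + |e| * ((k + 1).factorial * 𝒦 * R₁ * D₁ ^ k) +
        (|ρ| + |ϑ - π|) * ((k + 1).factorial * 𝒦 * R₂ * D₂ ^ k) := by
  have hrows : ∀ {x : ℝ}, |x| < r → ∀ i, i ≤ 3 → ∀ s, ‖iteratedDeriv i (levelPoint μ K x) s - iteratedDeriv i (levelPoint μ K 0) s‖ ≤ RR i * |x| :=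
    fun hx => radialRows_le_three hA hA20 hd hr hlo hhi hA₃ hA₄ h0 h1 h2 h3 hx
  have hRR0 : ∀ i, i ≤ k → 0 ≤ RR i := fun i hi => radialRows_nonneg_of_le_three hr hrows i (hi.trans hk)
  exact abs_iteratedDeriv_partnerBand_ph_tangency_le_sharp hA hA20 hd hr hlo hhi hA₃ hA₄ hA₅ hA₆ (hk.trans (by norm_num)) hK hD hρ he hRR0
    (fun i hi s => hrows he i (hi.trans hk) s) (fun i hi s => hrows hρ i (hi.trans hk) s) ϑ hD₁0 hR₁0 hD₂0 hR₂0 hD₁ hR₁ hD₂ hR₂ θ φ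

end Sizes

end Summit.HubbardSuperconductivity.HubbardSuperconductivity.Theorems.C4a

end
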